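import Literature.NumberTheory.PAdicHodge.DeRhamOfTatePtPeriods
import Literature.NumberTheory.PAdicHodge.AinfWeierstrassEtaHasseCriterion
import Literature.NumberTheory.EllipticCurves.FormalGroupEtaHasseInvariantProofs
import Literature.NumberTheory.EllipticCurves.FormalGroupQuasiPeriodMulDefectCongruenceProofs
import Literature.NumberTheory.EllipticCurves.FormalGroupVerschiebungHasseZeroProofs
import Literature.NumberTheory.EllipticCurves.TateModuleProjSurjectiveProofs
import HarnessLib

/-!
# The η-Hasse witness (Nη): at an odd prime of good SUPERSINGULAR reduction some `τ ∈ T_pŴ(𝒪_{ℂ_F})` has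
# `R_p(τ₁) ∉ p𝒪_{ℂ_F}`, so `V_pE` is de Rham from the ω-witness (N1) alone (proofs only)

Topic `Literature/NumberTheory/PAdicHodge`; namespace `Literature.NumberTheory.PAdicHodge.AinfTop`. THEOREMS ONLY (no
definition, no named fact, no instance, no `sorry`). Sequel of `AinfWeierstrassEtaHasseCriterion` (η-Hasse congruence +
valuation condition ⇒ `R_p(u) ∉ p𝒪_{ℂ_F}` ⇒ `∫_t η ∉ Fil¹B_dR⁺`) and of `DeRhamOfTatePtPeriods` (hDR at good supersingular
reduction ⟸ (N1) ∧ (Nη)). This file DISCHARGES (Nη) for every integral Weierstrass equation `W/ℤ` and every odd prime `p`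
with `p ∤ Δ_W`, `A_p(W mod p) = 0`:

* §1 `prime_dvd_coeff_mulDefectInt`, **`not_prime_dvd_coeff_mulDefectInt_of_hasseCoeff_eq_zero`** — the η-Hasse
  congruence of `R_p = mulDefectInt W p` (tree `FormalGroupQuasiPeriodMulDefectCongruenceProofs`: `p ∣ R_j (j<p)`,
  `p ∣ R_p + g_{p−1}`) and the unit `g_{p−1} = B_p ≠ 0 (mod p)` at supersingular reduction (tree
  `FormalGroupEtaHasseInvariantProofs`).
* §2 **`norm_lt_norm_pow_of_mulPC_eq_zero`** — the valuation condition: for `u ∈ 𝔪_{ℂ_F}`, `u ≠ 0`, `[p]_W(u) = 0`,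
  `‖p‖ < ‖u‖^p` (every non-zero `p`-torsion point lies outside the canonical subgroup: `[p](X) ≡ 0 (mod p, X^{p²})`
  at height `2`, tree `coeff_formalMul_prime_eq_zero_of_hasseCoeff_eq_zero`, and the isosceles principle:
  `‖pu‖ = ‖Σ_{2≤j<p²} bⱼuʲ + u^{p²}G(u)‖ ≤ ‖u‖^{p²}`).
* §3 **`exists_tatePt_seq_one_ne_zero`** — `T_pŴ(𝒪_{ℂ_F})` has an element with non-zero first coordinate: a non-zero
  `P ∈ E(F̄)[p]` (`#E[p] = p²`), lifted to `T_pE(F̄)` (`proj_surjective_of_isAlgClosed_holds`) and transported by the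
  matching `tateGeomEquivTatePtSS : T_pE(F̄) ≃ T_pŴ(𝒪_{ℂ_F})` (`z(P) ≠ 0` on `E₁`).
* §4 **`exists_tatePt_mulDefectC_not_mem`** — (Nη): `∃ τ, R_p(τ₁) ∉ p𝒪_{ℂ_F}`; hence
  **`isDeRham_rationalTateRep_curveF_of_omegaWitness`** / `isDeRham_restrictedRationalTateRep_of_omegaWitness`:
  `V_pE` is de Rham at an odd prime of good supersingular reduction as soon as ONE `τ` has `∫_τ ω ≠ 0` (N1).

BSD context: crux K★ `stmt-BirchSwinnertonDyer-22226` (route EdixhovenFibreFiveSeven), hDR sector (iii) road (A); what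
remains for hDR|ss of a `ℤ`-model is (N1) (the Hodge–Tate/tilt estimate `[t] ∉ Fil²`), and for the K★ cells the
ramified-coefficient version (R1). BSD is not proved by any of this.

## References
* P. Colmez, *Périodes p-adiques des variétés abéliennes*, Math. Ann. 292 (1992), §2. [Colmez1992PeriodesAbeliennes]
* J.-M. Fontaine, Invent. Math. 65 (1982), §5. [Fontaine1982FormesDifferentielles]
* J.-P. Serre, *Propriétés galoisiennes des points d'ordre fini des courbes elliptiques*, Invent. Math. 15 (1972), §1.11.
  [Serre1972]
* J. H. Silverman, *The Arithmetic of Elliptic Curves* (2009), III.6.4, III.§7, IV.4.4, VII.2.2. [SilvermanAEC2009]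
-/

noncomputable section

open scoped Classical
open Ideal Filter Topology Field WittVector MvPowerSeries

namespace Literature.NumberTheory.PAdicHodge

open Literature Literature.NumberTheory.GaloisRepresentations Literature.NumberTheory.EllipticCurves WeierstrassCurve
open Literature.NumberTheory.GaloisRepresentations.IsNonarchimedeanLocalField Field ValuativeRel
open Literature.NumberTheory.GaloisRepresentations.LubinTate Literature.NumberTheory.EllipticCurves.FormalGroupChart

namespace AinfTop

/-! ## §1 The η-Hasse congruence for `mulDefectInt` and the unit at supersingular reduction -/

section EtaHasse

variable {p : ℕ} [Fact p.Prime] (W : WeierstrassCurve ℤ)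

/-- **`p ∣ R_j` for `j < p`** (`R_p = mulDefectInt W p`). [cite: Colmez1992PeriodesAbeliennes, §2] -/
theorem prime_dvd_coeff_mulDefectInt {j : ℕ} (hj : j < p) : (p : ℤ) ∣ PowerSeries.coeff j (mulDefectInt W p) :=
  W.prime_dvd_coeff_of_map_eq_formalQuasiPeriodMulDefect (map_mulDefectInt W p) hj

/-- **`p ∣ R_p + g_{p−1}`**: the top coefficient of the η-Hasse congruence for `mulDefectInt`.
[cite: Colmez1992PeriodesAbeliennes, §2] -/
theorem prime_dvd_coeff_mulDefectInt_add : (p : ℤ) ∣ PowerSeries.coeff p (mulDefectInt W p) +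
    PowerSeries.coeff (p - 1) W.formalQuasiPeriodIntegrand :=
  W.prime_dvd_coeff_prime_add_coeff_formalQuasiPeriodIntegrand (map_mulDefectInt W p)

/-- **`p ∤ R_p` at an odd prime of good supersingular reduction** (`p ∤ Δ_W`, `A_p(W mod p) = 0`): `R_p ≡ −g_{p−1}`
and `g_{p−1} ≡ B_p ≢ 0 (mod p)`. [cite: Colmez1992PeriodesAbeliennes, §2] -/
theorem not_prime_dvd_coeff_mulDefectInt_of_hasseCoeff_eq_zero (hp2 : p ≠ 2) (hΔ : ¬ (p : ℤ) ∣ W.Δ)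
    (hA : (W.map (Int.castRingHom (ZMod p))).hasseCoeff p = 0) :
    ¬ (p : ℤ) ∣ PowerSeries.coeff p (mulDefectInt W p) := fun h =>
  prime_not_dvd_coeff_formalQuasiPeriodIntegrand_of_hasseCoeff_eq_zero hp2 W hΔ hA
    ((dvd_add_right h).mp (prime_dvd_coeff_mulDefectInt_add W))

end EtaHasse

/-! ## §2 The valuation of the `p`-torsion at supersingular reduction: `‖p‖ < ‖u‖^p` -/

section Valuation

variable {F : Type} [Field F] [ValuativeRel F] [TopologicalSpace F] [IsNonarchimedeanLocalField F] [CharZero F]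
  {p : ℕ} [Fact p.Prime] (W : WeierstrassCurve ℤ)

/-- At supersingular reduction `p ∣ [Xʲ][p]_W` for every `j` with `p² ∤ j` (height `2`; tree
`coeff_formalMul_prime_eq_zero_of_hasseCoeff_eq_zero` read over `ℤ`). [cite: SilvermanAEC2009, IV.7.5] -/
theorem prime_dvd_coeff_formalMul_prime_of_hasseCoeff_eq_zero (hp2 : p ≠ 2)
    (hA : (W.map (Int.castRingHom (ZMod p))).hasseCoeff p = 0) {j : ℕ} (hj : ¬ p ^ 2 ∣ j) :
    (p : ℤ) ∣ PowerSeries.coeff j (W.formalMul p) := by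
  rw [← ZMod.intCast_zmod_eq_zero_iff_dvd, ← eq_intCast (Int.castRingHom (ZMod p)), ← PowerSeries.coeff_map,
    map_formalMul]
  exact (W.map (Int.castRingHom (ZMod p))).coeff_formalMul_prime_eq_zero_of_hasseCoeff_eq_zero p hp2 hA hj

/-- **`‖p‖ < ‖u‖^p` for a non-zero `p`-torsion point of `Ŵ(𝔪_{ℂ_F})` at an odd prime of supersingular reduction**
(`A_p(W mod p) = 0`): from `0 = [p](u) = pu + Σ_{2≤j<p²} bⱼuʲ + u^{p²}G(u)` with `p ∣ bⱼ` (height `2`) the isosceles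
principle gives `‖p‖·‖u‖ = ‖u^{p²}G(u)‖ ≤ ‖u‖^{p²}`, so `‖p‖ ≤ ‖u‖^{p²−1} < ‖u‖^p`. (Serre: the points of order `p`
have valuation `1/(p²−1)`.) [cite: Serre1972, §1.11] [cite: SilvermanAEC2009, IV.7.5] -/
theorem norm_lt_norm_pow_of_mulPC_eq_zero (hp2 : p ≠ 2) (hA : (W.map (Int.castRingHom (ZMod p))).hasseCoeff p = 0)
    (u : (maxNilIdealC F).toIdeal) (hu0 : ((u : CBall F) : CompletedAlgClosure F) ≠ 0)
    (hpu : (mulPC F p W u : CBall F) = 0) :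
    ‖(p : CompletedAlgClosure F)‖ < ‖((u : CBall F) : CompletedAlgClosure F)‖ ^ p := by
  have hp : p.Prime := Fact.out
  set x : CompletedAlgClosure F := ((u : CBall F) : CompletedAlgClosure F) with hx
  have hx1 : ‖x‖ < 1 := u.2
  have hxpos : 0 < ‖x‖ := norm_pos_iff.mpr hu0
  have hp0 : 0 < ‖(p : CompletedAlgClosure F)‖ := by
    refine norm_pos_iff.mpr fun h => hp.ne_zero ?_
    rw [← map_natCast (algebraMap F (CompletedAlgClosure F)), _root_.map_eq_zero] at h
    exact_mod_cast h
  -- `[p](u) = Σ_{j<p²} bⱼ uʲ + u^{p²}·G(u)`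
  obtain ⟨G, hG⟩ := aeval_eq_sum_add_pow_mul (F := F) (W.formalMul p) (p ^ 2 - 1) u
  have hp21 : p ^ 2 - 1 + 1 = p ^ 2 := Nat.sub_add_cancel (Nat.one_le_pow _ _ hp.pos)
  rw [hp21] at hG
  have heval : aeval ((maxNilIdealC F).hasEval fun _ : Unit => u) (W.formalMul p) = (mulPC F p W u : CBall F) := rfl
  rw [heval, hpu] at hG
  -- push to `ℂ_F`
  set b : ℕ → CompletedAlgClosure F := fun j => ((PowerSeries.coeff j (W.formalMul p) : ℤ) : CompletedAlgClosure F) * x ^ j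
    with hb
  have hsumC : (0 : CompletedAlgClosure F) = ∑ j ∈ Finset.range (p ^ 2), b j + x ^ (p ^ 2) * (G : CompletedAlgClosure F) := by
    have h := congrArg ((CBall F).subtype) hG
    rw [map_zero, map_add, map_sum, map_mul, map_pow] at h
    rw [h, hb]
    simp only [map_mul, map_pow, map_intCast, Subring.coe_subtype]
    rfl
  have h1mem : 1 ∈ Finset.range (p ^ 2) := Finset.mem_range.mpr (by nlinarith [hp.two_le])
  rw [← Finset.add_sum_erase _ _ h1mem] at hsumC
  have hb1 : b 1 = (p : CompletedAlgClosure F) * x := by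
    simp only [hb, WeierstrassCurve.coeff_one_formalMul', Int.cast_natCast, pow_one]
  -- the tail `B = Σ_{j ≠ 1} bⱼ uʲ` has `‖B‖ ≤ ‖p‖·‖u‖²`
  set B := ∑ j ∈ (Finset.range (p ^ 2)).erase 1, b j with hB
  have hBle : ‖B‖ ≤ ‖(p : CompletedAlgClosure F)‖ * ‖x‖ ^ 2 := by
    refine IsUltrametricDist.norm_sum_le_of_forall_le_of_nonneg (by positivity) fun j hj => ?_
    obtain ⟨hj1, hjr⟩ := Finset.mem_erase.mp hj
    rw [Finset.mem_range] at hjr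
    rcases Nat.eq_zero_or_pos j with rfl | hjpos
    · simp only [hb, PowerSeries.coeff_zero_eq_constantCoeff, WeierstrassCurve.constantCoeff_formalMul, Int.cast_zero,
        zero_mul, norm_zero]
      positivity
    · have hj2 : 2 ≤ j := by omega
      have hdvd : (p : ℤ) ∣ PowerSeries.coeff j (W.formalMul p) :=
        prime_dvd_coeff_formalMul_prime_of_hasseCoeff_eq_zero W hp2 hA fun h => absurd (Nat.le_of_dvd hjpos h) (by omega)
      obtain ⟨c, hc⟩ := hdvd
      rw [hb]
      simp only [hc, Int.cast_mul, Int.cast_natCast, norm_mul, norm_pow]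
      calc ‖(p : CompletedAlgClosure F)‖ * ‖(c : CompletedAlgClosure F)‖ * ‖x‖ ^ j
          ≤ ‖(p : CompletedAlgClosure F)‖ * 1 * ‖x‖ ^ 2 := by
            apply mul_le_mul _ (pow_le_pow_of_le_one hxpos.le hx1.le hj2) (by positivity) (by positivity)
            exact mul_le_mul_of_nonneg_left (IsUltrametricDist.norm_intCast_le_one _ c) (norm_nonneg _)
        _ = _ := by rw [mul_one]
  have hBlt : ‖B‖ < ‖b 1‖ := by
    rw [hb1, norm_mul]
    calc ‖B‖ ≤ ‖(p : CompletedAlgClosure F)‖ * ‖x‖ ^ 2 := hBle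
      _ < ‖(p : CompletedAlgClosure F)‖ * ‖x‖ := by
          rw [sq]
          gcongr
          exact mul_lt_of_lt_one_left hxpos hx1
  -- isosceles: `‖b₁ + B‖ = ‖b₁‖ = ‖p‖‖u‖`, and `b₁ + B = −u^{p²}G`
  have hiso : ‖b 1 + B‖ = ‖(p : CompletedAlgClosure F)‖ * ‖x‖ := by
    rw [IsUltrametricDist.norm_add_eq_max_of_norm_ne_norm (ne_of_gt hBlt), max_eq_left hBlt.le, hb1, norm_mul]
  have htail : b 1 + B = -(x ^ (p ^ 2) * (G : CompletedAlgClosure F)) := by linear_combination -hsumC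
  have hle : ‖(p : CompletedAlgClosure F)‖ * ‖x‖ ≤ ‖x‖ ^ (p ^ 2) := by
    rw [← hiso, htail, norm_neg, norm_mul, norm_pow]
    calc ‖x‖ ^ (p ^ 2) * ‖(G : CompletedAlgClosure F)‖ ≤ ‖x‖ ^ (p ^ 2) * 1 := by
          gcongr; exact (mem_unitBall_iff _).mp G.2
      _ = _ := mul_one _
  -- `‖p‖ ≤ ‖u‖^{p²−1} < ‖u‖^p`
  have hle' : ‖(p : CompletedAlgClosure F)‖ ≤ ‖x‖ ^ (p ^ 2 - 1) := by
    rw [← hp21, pow_succ] at hle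
    exact le_of_mul_le_mul_right hle hxpos
  refine hle'.trans_lt (pow_lt_pow_right_of_lt_one₀ hxpos hx1 ?_)
  have : p + 1 < p ^ 2 := by nlinarith [hp.two_le]
  omega

end Valuation

/-! ## §3 An element of `T_pŴ(𝒪_{ℂ_F})` with non-zero first coordinate -/

section Witness

variable {F : Type} [Field F] [ValuativeRel F] [TopologicalSpace F] [IsNonarchimedeanLocalField F] [CharZero F]
  {p : ℕ} [Fact p.Prime] (W : WeierstrassCurve ℤ)

/-- **`∃ τ ∈ T_pŴ(𝒪_{ℂ_F})` with `τ₁ ≠ 0`** at an odd prime of good supersingular reduction: take `P ∈ E(F̄)[p]`, `P ≠ O`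
(`#E[p] = p²`, AEC III.6.4), lift it to `T_pE(F̄)` (AEC III.§7) and transport along
`tateGeomEquivTatePtSS : T_pE(F̄) ≃ T_pŴ(𝒪_{ℂ_F})`; the first coordinate is `z(P) ≠ 0` (`P ∈ E₁(ℂ_F) ∖ O`).
[cite: SilvermanAEC2009, Cor. III.6.4] [cite: SilvermanAEC2009, Prop. VII.2.2] -/
theorem exists_tatePt_seq_one_ne_zero (hpC : ‖(p : CompletedAlgClosure F)‖ < 1) (hp2 : p ≠ 2)
    (hΔ : ¬ (p : ℤ) ∣ W.Δ) (hA : (W.map (Int.castRingHom (ZMod p))).hasseCoeff p = 0) :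
    ∃ τ : TatePt F p W, (((seq W τ 1 : (maxNilIdealC F).toIdeal) : CBall F) : CompletedAlgClosure F) ≠ 0 := by
  have hp : p.Prime := Fact.out
  have hΔ0 : W.Δ ≠ 0 := fun h => hΔ (h ▸ dvd_zero _)
  haveI : (curveF F W).IsElliptic := isElliptic_curveF_of_ne_zero W hΔ0
  haveI : CharZero (AlgebraicClosure F) :=
    charZero_of_injective_algebraMap (algebraMap F (AlgebraicClosure F)).injective
  -- a non-zero `p`-torsion point of `E(F̄)`
  have hpK : ((p : ℕ) : AlgebraicClosure F) ≠ 0 := Nat.cast_ne_zero.mpr hp.ne_zero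
  have hcard : Nat.card (geomTorsion (curveF F W) (p : ℤ)) = p ^ 2 :=
    WeierstrassCurve.card_torsionBy_eq_sq (E := (curveF F W).baseChange (AlgebraicClosure F)) hpK
  haveI : Finite (geomTorsion (curveF F W) (p : ℤ)) :=
    Nat.finite_of_card_ne_zero (by rw [hcard]; exact pow_ne_zero _ hp.ne_zero)
  haveI : Nontrivial (geomTorsion (curveF F W) (p : ℤ)) :=
    Finite.one_lt_card_iff_nontrivial.mp (by rw [hcard]; exact Nat.one_lt_pow two_ne_zero hp.one_lt)
  obtain ⟨⟨P, hP⟩, hP0⟩ := exists_ne (0 : geomTorsion (curveF F W) (p : ℤ))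
  have hPne : P ≠ 0 := fun h => hP0 (Subtype.ext h)
  -- lift to `T_pE(F̄)` and transport
  have hP1 : P ∈ geomTorsion (curveF F W) ((p ^ 1 : ℕ) : ℤ) := by rwa [pow_one]
  obtain ⟨a, ha⟩ := WeierstrassCurve.proj_surjective_of_isAlgClosed_holds (curveF F W) p 1 hP1
  refine ⟨tateGeomEquivTatePtSS F W p hpC hp2 hΔ hA a, ?_⟩
  -- first coordinate `= z(geomToC P)`
  have hss := mem_kernel_of_pow_prime_smul_eq_zero_ss (W := W) hpC hp2 hΔ hA
  have hseq : (((seq W (tateGeomEquivTatePtSS F W p hpC hp2 hΔ hA a) 1 : (maxNilIdealC F).toIdeal) : CBall F) :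
      CompletedAlgClosure F) = (geomToC W P).zCoord := by
    haveI := isElliptic_curveOverC (F := F) W hΔ0
    change (((seq W (tateModuleCEquivTatePt F W p hss (tateGeomEquivC F W p hΔ0 a)) 1 : (maxNilIdealC F).toIdeal) :
      CBall F) : CompletedAlgClosure F) = _
    rw [coe_seq_tateModuleCEquivTatePt, proj_tateGeomEquivC, ha]
  rw [hseq]
  -- `geomToC P ∈ E₁(ℂ_F)` is non-zero, so `z ≠ 0`
  have hQ0 : geomToC W P ≠ 0 := fun h => hPne (geomToC_injective W (h.trans (map_zero _).symm))
  have hQker : geomToC W P ∈ kernel (NormedField.valuation (K := CompletedAlgClosure F))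
      (curveOver (CompletedAlgClosure F) W) := hss 1 (geomToC W P) (by
    rw [pow_one, ← map_nsmul, AddSubgroup.torsionBy.nsmul_iff.mp hP, map_zero])
  exact fun h => hQ0 ((zCoord_eq_zero_iff hQker).mp h)

end Witness

/-! ## §4 (Nη) discharged, and hDR at good supersingular reduction from (N1) alone -/

section DeRham

variable {F : Type} [Field F] [ValuativeRel F] [TopologicalSpace F] [IsNonarchimedeanLocalField F] [CharZero F]
  {p : ℕ} [Fact p.Prime] [Fact (¬ IsUnit (p : integerC F))] [IsAdicComplete (Ideal.span {(p : integerC F)}) (integerC F)]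

omit [IsAdicComplete (Ideal.span {(p : integerC F)}) (integerC F)] in
/-- **(Nη) holds at every odd prime of good supersingular reduction**: for `W/ℤ` with `p ∤ Δ_W`, `A_p(W mod p) = 0`,
some `τ ∈ T_pŴ(𝒪_{ℂ_F})` has `R_p(τ₁) ∉ p𝒪_{ℂ_F}` (η-Hasse criterion `mulDefectC_not_mem_span_of_etaHasse` fed by §1–§3).
Hence `∫_τ η ∉ Fil¹B_dR⁺` (`etaPeriodHom_not_mem_filOne`). [cite: Colmez1992PeriodesAbeliennes, §2] -/
theorem exists_tatePt_mulDefectC_not_mem (W : WeierstrassCurve ℤ) (hp2 : p ≠ 2) (hΔ : ¬ (p : ℤ) ∣ W.Δ)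
    (hA : (W.map (Int.castRingHom (ZMod p))).hasseCoeff p = 0) :
    ∃ τ : TatePt F p W, mulDefectC W p (seq W τ 1) ∉ Ideal.span {(p : CBall F)} := by
  have hpC : ‖(p : CompletedAlgClosure F)‖ < 1 := norm_natCast_C_lt_one'
  obtain ⟨τ, hτ⟩ := exists_tatePt_seq_one_ne_zero W hpC hp2 hΔ hA
  refine ⟨τ, mulDefectC_not_mem_span_of_etaHasse W (fun j hj => prime_dvd_coeff_mulDefectInt W hj)
    (not_prime_dvd_coeff_mulDefectInt_of_hasseCoeff_eq_zero W hp2 hΔ hA) (seq W τ 1)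
    (pow_not_mem_span_of_norm_lt _ (seq W τ 1).2 ?_)⟩
  refine norm_lt_norm_pow_of_mulPC_eq_zero W hp2 hA (seq W τ 1) hτ ?_
  rw [mulPC_seq, seq_zero]

variable (hp : valuation F p < 1) [Algebra ℚ_[p] F]

/-- **`V_pE` is de Rham at an odd prime of good SUPERSINGULAR reduction, from the ω-witness alone.** For `W/ℤ`, an odd
prime `p` with `p ∤ Δ_W`, `A_p(W mod p) = 0`, and a `p`-adic field `F`: if ONE `τ ∈ T_pŴ(𝒪_{ℂ_F})` has `∫_τ ω ≠ 0` (N1),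
then `GaloisRep.IsDeRham (bdRPeriodRingData hp) (rationalTateRep (curveF F W) p)` — tree
`isDeRham_rationalTateRep_curveF_of_tatePtPeriods` with (Nη) supplied by `exists_tatePt_mulDefectC_not_mem`.
BSD is not proved by this; (N1) and the ramified-coefficient version (R1) remain. [cite: Fontaine1982FormesDifferentielles, §5]
[cite: Colmez1992PeriodesAbeliennes, §2] -/
theorem isDeRham_rationalTateRep_curveF_of_omegaWitness (W : WeierstrassCurve ℤ) [(curveF F W).IsElliptic]
    (hp2 : p ≠ 2) (hΔ : ¬ (p : ℤ) ∣ W.Δ) (hA : (W.map (Int.castRingHom (ZMod p))).hasseCoeff p = 0)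
    (hN1 : ∃ τ : TatePt F p W, omegaPeriodHom W (surjective_fontaineTheta_integerC hp) τ ≠ 0) :
    GaloisRep.IsDeRham (bdRPeriodRingData (F := F) (p := p) hp) (rationalTateRep (curveF F W) p) :=
  isDeRham_rationalTateRep_curveF_of_tatePtPeriods hp W hp2 hΔ hA hN1 (exists_tatePt_mulDefectC_not_mem W hp2 hΔ hA)

/-- **hDR for `E/K₀` (`K₀ ⊆ F`) with a `ℤ`-model of good supersingular reduction at the odd prime `p`, from (N1) alone**,
in the currency `restrictedRationalTateRep` of the cite-only fact `isDeRham_restrictedRationalTateRep`. BSD is not proved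
by this. [cite: Fontaine1982FormesDifferentielles, §5] [cite: Colmez1992PeriodesAbeliennes, §2] -/
theorem isDeRham_restrictedRationalTateRep_of_omegaWitness {K₀ : Type} [Field K₀] [CharZero K₀] [Algebra K₀ F]
    (W₀ : WeierstrassCurve K₀) [W₀.IsElliptic] (W : WeierstrassCurve ℤ) (hW : W₀.baseChange F = curveF F W)
    (hp2 : p ≠ 2) (hΔ : ¬ (p : ℤ) ∣ W.Δ) (hA : (W.map (Int.castRingHom (ZMod p))).hasseCoeff p = 0)
    (hN1 : ∃ τ : TatePt F p W, omegaPeriodHom W (surjective_fontaineTheta_integerC hp) τ ≠ 0) :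
    GaloisRep.IsDeRham (bdRPeriodRingData (F := F) (p := p) hp) (restrictedRationalTateRep W₀ F p) :=
  isDeRham_restrictedRationalTateRep_of_tatePtPeriods hp W₀ W hW hp2 hΔ hA hN1
    (exists_tatePt_mulDefectC_not_mem W hp2 hΔ hA)

end DeRham

end AinfTop

end Literature.NumberTheory.PAdicHodge

end
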